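import Summits.BirchSwinnertonDyer.BirchSwinnertonDyer.Theorems.SchneiderFreeAdditiveX3AnticycControlAdditivePtSurjAnyTorsion
import Summits.BirchSwinnertonDyer.BirchSwinnertonDyer.Theorems.SchneiderFreeAdditiveX3AnticycControlAdditiveBaseCountFiniteAnyTorsion
import Summits.BirchSwinnertonDyer.BirchSwinnertonDyer.Theorems.SchneiderFreeAdditiveX3AnticycControlAdditiveCoinvAnyTorsion
import Summits.BirchSwinnertonDyer.BirchSwinnertonDyer.Theorems.SchneiderFreeAdditiveX3AnticycControlAdditiveKStubKerRes
import Summits.BirchSwinnertonDyer.BirchSwinnertonDyer.Theorems.SchneiderFreeAdditiveX3AnticycControlAdditiveKStubKerLoc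
import Summits.BirchSwinnertonDyer.Rank1Residual.X11b.RouteR1LocalKernelRecord
import Summits.BirchSwinnertonDyer.BirchSwinnertonDyer.Theses.SchneiderFreeAdditiveX3
import HarnessLib

/-!
# Crux `AnticycControlAdditiveK` (route `SchneiderFreeAdditiveX3`, item stmt-BirchSwinnertonDyer-19295)
# BY NAME, and the rev-9 regime-B2 item `ControlGlobalPTorsionF` (stmt-BirchSwinnertonDyer-19547),
# from the cited facts and the SINGLE remaining stub `stub_baseCountTors` (the exact (P6-add-tors) count)

Seat `bsd-schneider-door-c6` (cell `bsd-schneider-ideate`). Assembly of the whole torsion-robust chain: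
door-c4 gen 0's glue `additiveControlOnTreeAt_of_torsAtoms` (p420051) takes, at every frame, (KER-res)
`#ker res = p^g`, (KER-𝔭) `#ker r_𝔭 = p^t`, (P6-add-tors) the exact base count, (P9-𝓒) Poitou–Tate
surjectivity in element form, (L10) trivial coinvariants and (P11) the local kernel orders at `Σ(N⁺)`.
Now: (KER-res), (KER-𝔭) are door-c5 gen 4's UNCONDITIONAL `stub_kerRes` / `stub_kerLoc`; (P9-𝓒) is this
seat's `stub_ptSurj_of_poitouTate` (below: `stub_ptSurj_of_facts` with its finiteness hypothesis
discharged by `finite_selmerAcBase_of_rankOne_anyTorsion`), (L10) this seat's `stub_coinv_of_poitouTate`,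
(P11) route R1's `r1LocalKernelOrderAt_of_anticyclotomicDecomposition` (Brink 2007). Hence:

* `finite_selmerAcBase_of_kolyvagin` — the FINITENESS clause of `stub_baseCountTors` at every frame;
* `stub_ptSurj_of_poitouTate` — the REGISTERED `stub_ptSurj` ⇐ (∀ K, PT duality) + Kolyvagin, nothing else;
* **`anticycControlAdditiveK_of_facts_of_baseCountTors`** — the route decl
  `Summit.BirchSwinnertonDyer.BirchSwinnertonDyer.Theses.SchneiderFreeAdditiveX3.AnticycControlAdditiveK`
  ⇐ (∀ K, `poitouTate_selmerStructure_duality K`) + (∀ K, `poitouTate_sha_tateDual K`) +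
  (∀ K p, Brink `decomp_not_le_kerSubgroup_of_isAnticyclotomic K p`) + the statement of `stub_baseCountTors`
  (EVERY regime: `t_p = 0`/`t_p ≥ 1`, `E(K)[p] = 0`/`≠ 0` — the chain is uniform in `g` and `t`);
* **`controlGlobalPTorsionF_of_baseCountTors`** — the rev-9 item `ControlGlobalPTorsionF` (regime B2) ⇐
  the statement of `stub_baseCountTors` alone (its own antecedents supply the facts).

So under the route base unit's rev-9 design the ONLY mathematics left on the control corner is the EXACT
torsion-aware base count `a = ord_p #Ш + 2(ord_p log_ω P − ord_p[E(K):ℤP]) + ord_p ∏_{w∣p} c_w + g − t`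
(door-c4 gen 2 at `g = 0`; open at `g ≥ 1`) — plus Fin_v where `t = t_p` is wanted. CONDITIONAL
(hypotheses BY NAME); no `Prop` fact minted; closes nothing by itself; BSD is not proved by any of this.

References: [JetchevSkinnerWan2017] Thm. 3.3.1, Prop. 3.2.1, Prop. 3.3.2, Lemma 3.3.3 (arXiv:1512.06894
pp. 10–13); [Castella2018] Thm. 2.3; [Brink2007] Thm. 2, Cor. 1; [Gross1991] Thm. 1.3; [MilneADT2006]
I 4.10; [Harari2020] Thm. 17.13 (b).
-/

noncomputable section

open scoped Classical
open Field NumberField IsDedekindDomain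
open Literature.NumberTheory.EllipticCurves Literature.NumberTheory.EllipticCurves.GreenbergSelmer
open Literature.NumberTheory.GaloisRepresentations
open Literature.NumberTheory.GaloisCohomology

set_option linter.dupNamespace false

namespace Summit.BirchSwinnertonDyer.BirchSwinnertonDyer.Theorems.SchneiderFreeAdditiveX3

open Summit.BirchSwinnertonDyer.Rank1Residual.X11b
open Summit.BirchSwinnertonDyer.Rank1Residual.X11b.AcSelmer
open Summit.BirchSwinnertonDyer.Rank1Residual.X11b.LocBridge

/-! ## The finiteness clause of (P6-add-tors) at every B6 frame from Kolyvagin, and the registered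
stub `stub_ptSurj` modulo the cited Poitou–Tate fact and the crux's own Kolyvagin antecedent ONLY -/

section OfFacts

open WeierstrassCurve Literature.NumberTheory.EllipticCurves.ModularForms
  Literature.NumberTheory.EllipticCurves.Rank1Residual
  Literature.NumberTheory.EllipticCurves.Rank1Residual.Typed
  Summit.BirchSwinnertonDyer.Rank1Residual
  Summit.BirchSwinnertonDyer.BirchSwinnertonDyer.Theorems.SchneiderFree
  Summit.BirchSwinnertonDyer.BirchSwinnertonDyer.Theorems.SchneiderFreeControlAtoms

/-- **The FINITENESS clause of the registered stub `stub_baseCountTors` (P6-add-tors) at EVERY B6 frame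
(any `g`, any `t`)**, from the crux's Kolyvagin antecedent (`rank E(K) = 1`, `Ш(E/K)` finite for the
non-torsion Heegner point) and the cited Poitou–Tate reciprocity for `K`: `Sel_𝔭(K, E[p^∞])` is finite
(`finite_selmerAcBase_of_rankOne_anyTorsion`; `p` splits in `K` by the Heegner hypothesis and `p ∣ N_E`).
[cite: JetchevSkinnerWan2017, Prop. 3.2.1 (arXiv:1512.06894 pp. 10–11)] [cite: Gross1991, Thm. 1.3]
[cite: MilneADT2006, Ch. I, Thm. 4.10(b)] -/
theorem finite_selmerAcBase_of_kolyvagin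
    (hPT : ∀ (K : Type) [Field K] [NumberField K], poitouTate_selmerStructure_duality K)
    (hKo : ∀ (N : ℕ) [NeZero N] (W : WeierstrassCurve ℚ) (K : Type) [Field K] [NumberField K],
      Literature.NumberTheory.EllipticCurves.kolyvagin N W K) :
    ∀ (W : WeierstrassCurve ℚ) [W.IsElliptic] [W.IsGloballyMinimal] (p : ℕ) [Fact p.Prime],
      W.analyticRank = 1 → p ≠ 2 → ClassX3 W p → Additive.SubSemistableTwist W p →
      ∀ (N : ℕ) [NeZero N] (K : Type) [Field K] [NumberField K]
        (Dt : ModularParametrizationData W N) (H : HeegnerDatum N (NumberField.discr K)) (ι : K →+* ℂ)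
        (P : (W.baseChange K).toAffine.Point),
        W.analyticRank = 1 → Additive.N10.Locus W p → W.conductorNorm ℤ = N →
        ∀ hK : IsImaginaryQuadratic K,
        Odd (NumberField.discr K) → ¬ p ∣ Units.torsionOrder K → SatisfiesHeegnerHypothesis N K →
        (W.quadraticTwist (NumberField.discr K : ℚ)).entireLFunction 1 ≠ 0 →
        WeierstrassCurve.Affine.Point.map ι.toRatAlgHom P = heegnerPointComplex Dt H →
        ¬ IsOfFinAddOrder P →
        ∀ (κ : ZpExtension K p), κ.IsAnticyclotomic →
          ∀ (γ : Field.absoluteGaloisGroup K) [Fact (κ.IsTopGenerator γ)]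
            (𝔭 : HeightOneSpectrum (𝓞 K)) (h𝔭 : ((p : ℕ) : 𝓞 K) ∈ 𝔭.asIdeal)
            (he : 𝔭.asIdeal.ramificationIdx (𝓞 ℚ) = 1) (hf : 𝔭.asIdeal.inertiaDeg (𝓞 ℚ) = 1),
            Finite (selmerAcBase (W.baseChange K) p 𝔭 ∅) := by
  intro W _ _ p _ _ _ _ _ N _ K _ _ Dt H ι P _ hloc hN hK _ _ hHe _ hP hnt κ _ γ _ 𝔭 h𝔭 he hf
  have hpN : p ∣ W.conductorNorm ℤ := dvd_conductorNorm_of_n10Locus hloc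
  have hsplit : SplitsIn K p := splitsIn_of_satisfiesHeegnerHypothesis hN hHe hpN
  obtain ⟨hrank, hSha⟩ := hKo N W K hK hHe ⟨Dt, H, ι, hP⟩ hnt
  exact finite_selmerAcBase_of_rankOne_anyTorsion W p K
    (poitouTate_sum_localTatePairing_eq_zero_of_selmerStructure_duality (hPT K)) hK hsplit hrank hSha
    𝔭 h𝔭 he hf

/-- **The registered stub `stub_ptSurj` (signature VERBATIM) from the cited Poitou–Tate duality for
Selmer structures (for every number field) and the crux's own Kolyvagin antecedent — NOTHING ELSE**
(`stub_ptSurj_of_facts` with its finiteness hypothesis discharged by `finite_selmerAcBase_of_kolyvagin`):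
every frame, any global torsion `g` (regime B2 included), any local torsion `t`. Under the route base
unit's rev-9 design (`ControlFacts → kolyvagin → …`) this is the (P9-𝓒) component of BOTH regime stubs.
[cite: JetchevSkinnerWan2017, Prop. 3.3.2 and Prop. 3.2.1 (arXiv:1512.06894 pp. 10–11)]
[cite: MilneADT2006, Ch. I, Thm. 4.10(b)] [cite: Howard2004HeegnerKolyvagin, Thm. 2.1.11 (arXiv:1202.6340 p. 6)] -/
theorem stub_ptSurj_of_poitouTate
    (hPT : ∀ (K : Type) [Field K] [NumberField K], poitouTate_selmerStructure_duality K)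
    (hKo : ∀ (N : ℕ) [NeZero N] (W : WeierstrassCurve ℚ) (K : Type) [Field K] [NumberField K],
      Literature.NumberTheory.EllipticCurves.kolyvagin N W K) :
    ∀ (W : WeierstrassCurve ℚ) [W.IsElliptic] [W.IsGloballyMinimal] (p : ℕ) [Fact p.Prime],
      W.analyticRank = 1 → p ≠ 2 → ClassX3 W p → Additive.SubSemistableTwist W p →
      ∀ (N : ℕ) [NeZero N] (K : Type) [Field K] [NumberField K]
        (Dt : ModularParametrizationData W N) (H : HeegnerDatum N (NumberField.discr K)) (ι : K →+* ℂ)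
        (P : (W.baseChange K).toAffine.Point),
        W.analyticRank = 1 → Additive.N10.Locus W p → W.conductorNorm ℤ = N →
        ∀ hK : IsImaginaryQuadratic K,
        Odd (NumberField.discr K) → ¬ p ∣ Units.torsionOrder K → SatisfiesHeegnerHypothesis N K →
        (W.quadraticTwist (NumberField.discr K : ℚ)).entireLFunction 1 ≠ 0 →
        WeierstrassCurve.Affine.Point.map ι.toRatAlgHom P = heegnerPointComplex Dt H →
        ¬ IsOfFinAddOrder P →
        ∀ (κ : ZpExtension K p), κ.IsAnticyclotomic →
          ∀ (γ : Field.absoluteGaloisGroup K) [Fact (κ.IsTopGenerator γ)]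
            (𝔭 : HeightOneSpectrum (𝓞 K)) (h𝔭 : ((p : ℕ) : 𝓞 K) ∈ 𝔭.asIdeal)
            (he : 𝔭.asIdeal.ramificationIdx (𝓞 ℚ) = 1) (hf : 𝔭.asIdeal.inertiaDeg (𝓞 ℚ) = 1),
            (∀ x : Π v : ↥(insert 𝔭 (nPlusPlaces_finite (W := W) (p := p) (K := K) hK.1).toFinset),
                  Literature.NumberTheory.EllipticCurves.subgroupH1
                    ((⊤ : Subgroup (absoluteGaloisGroup K)) ⊓ decomp (v : HeightOneSpectrum (𝓞 K)))
                    ((W.baseChange K).geomPrimaryTorsion p),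
                (∀ v : ↥(insert 𝔭 (nPlusPlaces_finite (W := W) (p := p) (K := K) hK.1).toFinset),
                  x v ∈ localKer κ.kerSubgroup ((W.baseChange K).geomPrimaryTorsion p)
                    (v : HeightOneSpectrum (𝓞 K))) →
                  ∃ c : (W.baseChange K).subgroupH1 p (⊤ : Subgroup (absoluteGaloisGroup K)),
                    locAtFinset (W.baseChange K) p _ c = x ∧
                    ∀ v : HeightOneSpectrum (𝓞 K), ((p : ℕ) : 𝓞 K) ∉ v.asIdeal → v ∉ (∅ : Set _) →
                      v ∉ insert 𝔭 (nPlusPlaces_finite (W := W) (p := p) (K := K) hK.1).toFinset →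
                        c ∈ awayKer ⊤ ((W.baseChange K).geomPrimaryTorsion p) v) :=
  stub_ptSurj_of_facts hPT (fun hKo' ↦ finite_selmerAcBase_of_kolyvagin hPT hKo') hKo

end OfFacts

/-! ## The crux `AnticycControlAdditiveK` and the rev-9 regime-B2 item `ControlGlobalPTorsionF` from the
cited facts and the SINGLE remaining stub `stub_baseCountTors` (exact (P6-add-tors) count) -/

section CruxAssembly

open WeierstrassCurve Literature.NumberTheory.EllipticCurves.ModularForms
  Literature.NumberTheory.EllipticCurves.Rank1Residual
  Literature.NumberTheory.EllipticCurves.Rank1Residual.Typed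
  Summit.BirchSwinnertonDyer.Rank1Residual
  Summit.BirchSwinnertonDyer.BirchSwinnertonDyer.Theorems.SchneiderFree
  Summit.BirchSwinnertonDyer.BirchSwinnertonDyer.Theorems.SchneiderFreeControlAtoms

/-- **The crux `AnticycControlAdditiveK` (item stmt-BirchSwinnertonDyer-19295) BY NAME from the cited
facts — Poitou–Tate duality for Selmer structures and for `Ш` (every number field), Brink 2007 Cor. 1
(split primes finitely decomposed in the anticyclotomic tower) — and the ONE remaining registered stub
`stub_baseCountTors` (the EXACT torsion-aware base count (P6-add-tors), taken as a hypothesis with its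
Kolyvagin prefix).** Every frame, EVERY regime (t_p = 0 / t_p ≥ 1, g = 0 / g ≥ 1): (KER-res) and (KER-𝔭)
are door-c5's unconditional `stub_kerRes` / `stub_kerLoc`; (P9-𝓒) and (L10) are this seat's
`stub_ptSurj_of_poitouTate` / `stub_coinv_of_poitouTate`; (P11) is route R1's
`r1LocalKernelOrderAt_of_anticyclotomicDecomposition` (Brink); the glue is door-c4's
`additiveControlOnTreeAt_of_torsAtoms`. CONDITIONAL (hypotheses BY NAME); BSD is not proved by this.
[cite: JetchevSkinnerWan2017, Thm. 3.3.1, Prop. 3.2.1, Prop. 3.3.2, Lemma 3.3.3 (arXiv:1512.06894 pp. 10–13)]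
[cite: Castella2018, Thm. 2.3 (arXiv:1704.06608 p. 5)] [cite: Brink2007, Thm. 2 and Cor. 1] -/
theorem anticycControlAdditiveK_of_facts_of_baseCountTors
    (hPT : ∀ (K : Type) [Field K] [NumberField K], poitouTate_selmerStructure_duality K)
    (hPT2 : ∀ (K : Type) [Field K] [NumberField K], poitouTate_sha_tateDual K)
    (hBr : ∀ (K : Type) [Field K] [NumberField K] (p : ℕ) [Fact p.Prime],
      ZpExtension.decomp_not_le_kerSubgroup_of_isAnticyclotomic K p)
    (h6 : (∀ (N : ℕ) [NeZero N] (W : WeierstrassCurve ℚ) (K : Type) [Field K] [NumberField K],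
        Literature.NumberTheory.EllipticCurves.kolyvagin N W K) →
      ∀ (W : WeierstrassCurve ℚ) [W.IsElliptic] [W.IsGloballyMinimal] (p : ℕ) [Fact p.Prime],
      W.analyticRank = 1 → p ≠ 2 → ClassX3 W p → Additive.SubSemistableTwist W p →
      ∀ (N : ℕ) [NeZero N] (K : Type) [Field K] [NumberField K]
        (Dt : ModularParametrizationData W N) (H : HeegnerDatum N (NumberField.discr K)) (ι : K →+* ℂ)
        (P : (W.baseChange K).toAffine.Point),
        W.analyticRank = 1 → Additive.N10.Locus W p → W.conductorNorm ℤ = N →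
        ∀ hK : IsImaginaryQuadratic K,
        Odd (NumberField.discr K) → ¬ p ∣ Units.torsionOrder K → SatisfiesHeegnerHypothesis N K →
        (W.quadraticTwist (NumberField.discr K : ℚ)).entireLFunction 1 ≠ 0 →
        WeierstrassCurve.Affine.Point.map ι.toRatAlgHom P = heegnerPointComplex Dt H →
        ¬ IsOfFinAddOrder P →
        ∀ (κ : ZpExtension K p), κ.IsAnticyclotomic →
          ∀ (γ : Field.absoluteGaloisGroup K) [Fact (κ.IsTopGenerator γ)]
            (𝔭 : HeightOneSpectrum (𝓞 K)) (h𝔭 : ((p : ℕ) : 𝓞 K) ∈ 𝔭.asIdeal)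
            (he : 𝔭.asIdeal.ramificationIdx (𝓞 ℚ) = 1) (hf : 𝔭.asIdeal.inertiaDeg (𝓞 ℚ) = 1),
            ∀ g t : ℕ, Nat.card ((W.baseChange K).resOfLe p (le_top : κ.kerSubgroup ≤ ⊤)).ker = p ^ g →
            Nat.card (localKer κ.kerSubgroup ((W.baseChange K).geomPrimaryTorsion p) 𝔭) = p ^ t →
            ∃ a : ℕ, ((∃ _ : Finite (selmerAcBase (W.baseChange K) p 𝔭 ∅),
                  Nat.card (selmerAcBase (W.baseChange K) p 𝔭 ∅) = p ^ a) ∧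
                (a : ℤ) = (padicValNat p
                    (Nat.card (AddCommGroup.primaryComponent (W.baseChange K).sha p)) : ℤ) +
                  2 * (X11b.padicLogOrd W p (embAt K p 𝔭 h𝔭 he hf) P -
                    (padicValNat p (AddSubgroup.zmultiples P).index : ℤ)) +
                    padicValNat p (X11b.tamagawaProductAbove W K p) + g - t)) :
    Summit.BirchSwinnertonDyer.BirchSwinnertonDyer.Theses.SchneiderFreeAdditiveX3.AnticycControlAdditiveK := by
  intro hKo W _ _ p _ hr hp2 hX hS N _ K _ _ Dt H ι P hr' hloc hN hK hodd hunit hHe hL1 hP hnt κ hκ γ _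
    𝔭 h𝔭 he hf
  have hpN : p ∣ W.conductorNorm ℤ := dvd_conductorNorm_of_n10Locus hloc
  have hsplit : SplitsIn K p := splitsIn_of_satisfiesHeegnerHypothesis hN hHe hpN
  obtain ⟨g, hg⟩ :=
    stub_kerRes W p hr hp2 hX hS N K Dt H ι P hr' hloc hN hK hodd hunit hHe hL1 hP hnt κ hκ γ 𝔭 h𝔭 he hf
  obtain ⟨t, ht⟩ :=
    stub_kerLoc W p hr hp2 hX hS N K Dt H ι P hr' hloc hN hK hodd hunit hHe hL1 hP hnt κ hκ γ 𝔭 h𝔭 he hf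
  obtain ⟨a, ha⟩ := h6 hKo W p hr hp2 hX hS N K Dt H ι P hr' hloc hN hK hodd hunit hHe hL1 hP hnt κ hκ γ
    𝔭 h𝔭 he hf g t hg ht
  exact additiveControlOnTreeAt_of_torsAtoms (W := W) hK hsplit hpN hκ γ 𝔭 h𝔭 (embAt K p 𝔭 h𝔭 he hf)
    P g t a hg ht ha
    (stub_ptSurj_of_poitouTate hPT hKo W p hr hp2 hX hS N K Dt H ι P hr' hloc hN hK hodd hunit hHe hL1
      hP hnt κ hκ γ 𝔭 h𝔭 he hf)
    (stub_coinv_of_poitouTate hPT hPT2 hKo W p hr hp2 hX hS N K Dt H ι P hr' hloc hN hK hodd hunit hHe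
      hL1 hP hnt κ hκ γ 𝔭 h𝔭 he hf)
    (r1LocalKernelOrderAt_of_anticyclotomicDecomposition (W := W) (p := p) hBr hp2 K hK κ hκ)

/-- **Item stmt-BirchSwinnertonDyer-19547 `ControlGlobalPTorsionF` (regime B2 of the control corner,
rev 9) from the same single remaining stub**: its antecedents include the three facts above, the
Kolyvagin fact and more (Brink above `p`, Fin_v, `E(K)[p] ≠ 0`), none of which the torsion-robust
chain needs beyond what `anticycControlAdditiveK_of_facts_of_baseCountTors` consumes.
[cite: JetchevSkinnerWan2017, Thm. 3.3.1 (arXiv:1512.06894 p. 11)] -/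
theorem controlGlobalPTorsionF_of_baseCountTors
    (h6 : (∀ (N : ℕ) [NeZero N] (W : WeierstrassCurve ℚ) (K : Type) [Field K] [NumberField K],
        Literature.NumberTheory.EllipticCurves.kolyvagin N W K) →
      ∀ (W : WeierstrassCurve ℚ) [W.IsElliptic] [W.IsGloballyMinimal] (p : ℕ) [Fact p.Prime],
      W.analyticRank = 1 → p ≠ 2 → ClassX3 W p → Additive.SubSemistableTwist W p →
      ∀ (N : ℕ) [NeZero N] (K : Type) [Field K] [NumberField K]
        (Dt : ModularParametrizationData W N) (H : HeegnerDatum N (NumberField.discr K)) (ι : K →+* ℂ)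
        (P : (W.baseChange K).toAffine.Point),
        W.analyticRank = 1 → Additive.N10.Locus W p → W.conductorNorm ℤ = N →
        ∀ hK : IsImaginaryQuadratic K,
        Odd (NumberField.discr K) → ¬ p ∣ Units.torsionOrder K → SatisfiesHeegnerHypothesis N K →
        (W.quadraticTwist (NumberField.discr K : ℚ)).entireLFunction 1 ≠ 0 →
        WeierstrassCurve.Affine.Point.map ι.toRatAlgHom P = heegnerPointComplex Dt H →
        ¬ IsOfFinAddOrder P →
        ∀ (κ : ZpExtension K p), κ.IsAnticyclotomic →
          ∀ (γ : Field.absoluteGaloisGroup K) [Fact (κ.IsTopGenerator γ)]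
            (𝔭 : HeightOneSpectrum (𝓞 K)) (h𝔭 : ((p : ℕ) : 𝓞 K) ∈ 𝔭.asIdeal)
            (he : 𝔭.asIdeal.ramificationIdx (𝓞 ℚ) = 1) (hf : 𝔭.asIdeal.inertiaDeg (𝓞 ℚ) = 1),
            ∀ g t : ℕ, Nat.card ((W.baseChange K).resOfLe p (le_top : κ.kerSubgroup ≤ ⊤)).ker = p ^ g →
            Nat.card (localKer κ.kerSubgroup ((W.baseChange K).geomPrimaryTorsion p) 𝔭) = p ^ t →
            ∃ a : ℕ, ((∃ _ : Finite (selmerAcBase (W.baseChange K) p 𝔭 ∅),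
                  Nat.card (selmerAcBase (W.baseChange K) p 𝔭 ∅) = p ^ a) ∧
                (a : ℤ) = (padicValNat p
                    (Nat.card (AddCommGroup.primaryComponent (W.baseChange K).sha p)) : ℤ) +
                  2 * (X11b.padicLogOrd W p (embAt K p 𝔭 h𝔭 he hf) P -
                    (padicValNat p (AddSubgroup.zmultiples P).index : ℤ)) +
                    padicValNat p (X11b.tamagawaProductAbove W K p) + g - t)) :
    Summit.BirchSwinnertonDyer.BirchSwinnertonDyer.Theses.SchneiderFreeAdditiveX3.ControlGlobalPTorsionF := by
  intro hPT hPT2 hBr _ hKo W _ _ p _ hr hp2 hX hS _ N _ K _ _ Dt H ι P hr' hloc hN hK hodd hunit hHe hL1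
    hP hnt κ hκ γ _ 𝔭 h𝔭 he hf _
  exact anticycControlAdditiveK_of_facts_of_baseCountTors hPT hPT2 hBr h6 hKo W p hr hp2 hX hS N K Dt H
    ι P hr' hloc hN hK hodd hunit hHe hL1 hP hnt κ hκ γ 𝔭 h𝔭 he hf

end CruxAssembly

end Summit.BirchSwinnertonDyer.BirchSwinnertonDyer.Theorems.SchneiderFreeAdditiveX3

end
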